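import Literature.IUT.LogVolume.GenuineLogThetaSlotChoice
import Literature.IUT.LogVolume.GenuineLogThetaIdeles
import HarnessLib

/-!
# The all-bad mass of a genuine Θ-volume input, and [IUTchIII] Cor. 3.12 at every genuine input whose bad places
# over each rational prime carry at most a third of the degree (Dupuy–Hilado §3.6, §4.7, §4.11–4.12; [IUTchIV] Step (v))

Record/proof-only file of the abc-iut cell (Cor. 3.12 crew, L-DH lane, seat abc-iut-c312-3; sequel to
`GenuineLogThetaSlotChoice.lean`, item «XXVIIc-DH»). TAKES NO SIDE on [IUTchIII] Cor. 3.12.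

`GenuineLogThetaSlotChoice.lean` bounds the genuine `−|log(Θ)|` below by the slot-selected Θ-mass for EVERY slot
selector. HERE the selector is the natural one — a slot carrying a GOOD place (outside `𝕍^bad`) when the tuple has
one, where the Θ-idele is a unit — and the resulting mass is computed in closed form by the independence of the
coordinates of `(𝕍(F₀)_p^{i+2}, Π Pr)`:

* `sum_apply_mul_prod_eq` — `Σ_{e ∈ α^{m+1}} f(e_i)·Π_b g(e_b) = (Σ_a f(a)g(a))·(Σ_a g(a))^m` (finite combinatorics);
* `sum_primes_sum_placesOver_of_eq`, `ThetaVolumeInput.ndeg_qPilot_eq_sum_primes` — a divisor supported on `𝕍^bad` is the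
  sum over `p ∈ T(I)` of its parts over `p`; `deĝ̲(P_q) = Σ_{p∈T(I)} deĝ̲(P_q|_p)`;
* **`ThetaVolumeInput.negLogThetaLoc_ge_badMass`** — at every prime `p`,
  `−(1/ℓ⋇)·Σ_{i<ℓ⋇} (i+1)²·β_p^{i+1}·deĝ̲(P_q|_p) ≤ negLogThetaLoc I p`, where
  `β_p := Σ_{v | p, v ∈ 𝕍^bad} Pr(v)` is the BAD MASS over `p` (the fraction of `[F₀:ℚ]` carried by the bad places over
  `p`) and `P_q|_p := Σ_{v|p} P_q(v)[v]`: only the tuples ALL of whose `i+2` slots are bad contribute, with total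
  weight `β_p^{i+2}`, one factor `β_p` being absorbed by `deĝ̲` ([IUTchIV] Step (v) with (Ind1) = all capsule-index
  permutations, HOME/plan/c312/STEPV-IND1-NOTE.md ruling R2; `P_{Θ,i} = (i+1)²·P_q`);
* **`negLogThetaNonarch_ge_badMass`** (sum over `T(I)`), and the SUFFICIENT CONDITIONS
  **`cor312NonarchOf_of_badMass_le`** / **`cor312Of_of_badMass_le`**: if `(1/ℓ⋇)·Σ_{i<ℓ⋇} (i+1)²·β_p^{i+1} ≤ 1` at
  every support prime then Dupuy–Hilado's (1.1) and [IUTchIII] Cor. 3.12 HOLD for the input; in particular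
  (**`cor312Of_of_badMass_le_third`**) they hold for EVERY genuine Θ-volume input with `β_p ≤ 1/3` at every `p`
  (`(i+1)²/3^{i+1} ≤ 1`) — whatever the depths `ord_v(q_v)`, whatever `l`, `K`, the ideles.

So in the tree's sharp Dupuy–Hilado-level model of the genuine data, the typed inequality of Cor. 3.12 is decided, on
a whole class of inputs, by the place combinatorics of `(F₀, 𝕍^bad)` alone: TRUE whenever the bad primes split enough
(this file), FALSE at a deep bad place that is alone over its prime (abc-iut-w5-d157 `LDHPerPrimeReading`, skeleton
XXVI at the summand level) — the DH-GLOBAL, genuine-input form of rows 5/7 of `HOME/skel/FORK-INDEX.md` («TRUE at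
mixed summands / FALSE where the Θ-gain lives, for reasons of place combinatorics orthogonal to the dispute»). No free
lunch: on this class the squeeze `LDHGenuine.gap_le_of_cor312Of` ([IUTchIV] Thm. 1.10) is vacuous, the (Ind1)-slot
term of `explicitDelta` absorbing the mixed mass; and the route to `Summit.ABC` runs over `F_mod = ℚ`, where every bad
prime has `β_p = 1`.

[cite: DupuyHilado2025, §3.3, §3.6, §4.7, §4.11, §4.12] [cite: Mochizuki2012, IUTchIV Thm. 1.10 Step (v) p. 27–28]
[cite: Mochizuki2012, IUTchIII Cor. 3.12 p. 173–174] [claim: Mochizuki2012, status: disputed] HONEST SCOPE: a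
theorem about the tree's typed objects ((Ind1)/(Ind2)/hull/sharp (Ind3) per the cell's typings of disputed-corpus
constructions, (Ind1) = ALL slot permutations); it asserts nothing about print's Cor. 3.12 and is no evidence either
way in the dispute. PROOF-ONLY file: no definitions, no named `Prop` facts; typed ≠ proved.
-/

noncomputable section

open Set Module NumberField IsDedekindDomain
open scoped Pointwise TensorProduct

namespace Literature.IUT.LogVolume

/-! ## Finite combinatorics: one coordinate against a product weight -/

/-- **`Σ_{e ∈ α^{m+1}} f(e_i)·Π_b g(e_b) = (Σ_a f(a)·g(a))·(Σ_a g(a))^m`** (split off the `i`-th coordinate,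
`α^{m+1} ≃ α × α^m`): the coordinate-independence of the product weights on tuples of places — "since products of
probability spaces are probability spaces the sets `V(F₀)_p^{r+1}` also have the natural structure of a probability
space" — for a general (not necessarily probability) weight `g`. [cite: DupuyHilado2025, §2.2, §3.6] -/
theorem sum_apply_mul_prod_eq {α : Type*} [Fintype α] (m : ℕ) (i : Fin (m + 1)) (f g : α → ℝ) :
    ∑ e : Fin (m + 1) → α, f (e i) * ∏ j, g (e j) = (∑ a, f a * g a) * (∑ a, g a) ^ m := by
  classical
  rw [← Fintype.sum_equiv (Fin.insertNthEquiv (fun _ => α) i)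
    (fun q : α × (Fin m → α) => f q.1 * (g q.1 * ∏ j, g (q.2 j)))
    (fun e : Fin (m + 1) → α => f (e i) * ∏ j, g (e j))]
  · rw [Fintype.sum_prod_type, Fintype.sum_pow, Finset.sum_mul]
    refine Finset.sum_congr rfl fun a _ => ?_
    simp only
    rw [← Finset.mul_sum, ← Finset.mul_sum]
    ring
  · intro q
    simp only [Fin.insertNthEquiv_apply, Fin.insertNth_apply_same]
    rw [Fin.prod_univ_succAbove _ i, Fin.insertNth_apply_same]
    simp only [Fin.insertNth_apply_succAbove]

/-- `n² ≤ 3^n` (numeric helper). [folklore] -/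
private theorem natCast_sq_le_three_pow (n : ℕ) : (n : ℝ) ^ 2 ≤ (3 : ℝ) ^ n := by
  have h : n ^ 2 ≤ 3 ^ n := by
    induction n with
    | zero => simp
    | succ k ih =>
      have hk : k < 3 ^ k := Nat.lt_pow_self (by norm_num)
      have h2 : (k + 1) ^ 2 = k ^ 2 + (2 * k + 1) := by ring
      have h3 : 3 ^ (k + 1) = 3 ^ k * 3 := pow_succ 3 k
      rw [h2, h3]
      omega
  exact_mod_cast h

/-! ## Divisors supported on the bad places, read prime by prime -/

section Divisors

variable {F : Type} [Field F] [NumberField F]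

/-- A divisor is the sum over the primes `p ∈ T` of its parts over `p`, when `T` (a set of primes) contains the
residue characteristics of its support — the regrouping "`deĝ̲(D) = Σ_p Σ_{v|p} …`" of the fake-adelic bookkeeping
(proof of Thm. 3.10.1; Literature-level twin of the summit-side lemma of `LDHCor312`).
[cite: DupuyHilado2025, §2.5.4, Thm. 3.10.1 proof] -/
theorem sum_primes_sum_placesOver_of_eq (E : FinDivisor F) (T : Finset ℕ) (hT : ∀ p ∈ T, p.Prime)
    (hE : ∀ v, E v ≠ 0 → residueChar F v ∈ T) :
    (∑ p ∈ T, ∑ v : placesOver F p, FinDivisor.of v.1 (E v.1)) = E := by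
  classical
  ext w
  have hw := mem_placesOver_residueChar w
  haveI : Fact (residueChar F w).Prime := ⟨residueChar_prime F w⟩
  have inner : ∀ p ∈ T, (∑ v : placesOver F p, FinDivisor.of v.1 (E v.1)) w =
      if w ∈ placesOver F p then E w else 0 := by
    intro p _
    rw [Finsupp.finsetSum_apply, Finset.sum_coe_sort (placesOver F p) (fun v => (FinDivisor.of v (E v)) w)]
    simp only [FinDivisor.of, Finsupp.single_apply]
    exact Finset.sum_ite_eq' (placesOver F p) w E
  rw [Finsupp.finsetSum_apply, Finset.sum_congr rfl inner]
  by_cases hEw : E w = 0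
  · rw [hEw]; simp
  · rw [Finset.sum_eq_single (residueChar F w)]
    · simp [hw]
    · intro p hp hne
      haveI : Fact p.Prime := ⟨hT p hp⟩
      rw [if_neg]
      rw [mem_placesOver_iff_residueChar]
      exact fun h => hne h.symm
    · intro h; exact absurd (hE w hEw) h

end Divisors

namespace ThetaVolumeInput

variable {F₀ : Type} [Field F₀] [NumberField F₀] {K : Type} [Field K] [NumberField K] [Algebra F₀ K]
variable (I : ThetaVolumeInput F₀ K)

/-- **`deĝ̲(P_q) = Σ_{p∈T(I)} deĝ̲(P_q|_p)`**, `P_q|_p := Σ_{v|p} P_q(v)[v]` (the `q`-pilot divisor is supported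
on `𝕍^bad`, whose residue characteristics are support primes). [cite: DupuyHilado2025, §3.3, §3.9] -/
theorem ndeg_qPilot_eq_sum_primes :
    FinDivisor.ndeg F₀ I.X.qPilot =
      ∑ p ∈ I.supportPrimes, FinDivisor.ndeg F₀ (∑ v : placesOver F₀ p, FinDivisor.of v.1 (I.X.qPilot v.1)) := by
  rw [← map_sum]
  congr 1
  refine (sum_primes_sum_placesOver_of_eq I.X.qPilot I.supportPrimes
    (fun _ hp => I.prime_of_mem_supportPrimes hp) fun v hv => ?_).symm
  by_contra h
  exact hv (I.X.qPilot_apply_of_not_mem fun hS => h (I.residueChar_mem_supportPrimes hS))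

/-- `deĝ̲(P_q|_p) ≥ 0` (effective divisor). [cite: DupuyHilado2025, §3.3] -/
theorem ndeg_qPilot_at_nonneg (p : ℕ) :
    0 ≤ FinDivisor.ndeg F₀ (∑ v : placesOver F₀ p, FinDivisor.of v.1 (I.X.qPilot v.1)) := by
  classical
  refine FinDivisor.ndeg_nonneg fun w => ?_
  rw [Finsupp.finsetSum_apply]
  refine Finset.sum_nonneg fun v _ => ?_
  simp only [FinDivisor.of, Finsupp.single_apply]
  split_ifs
  · by_cases hS : v.1 ∈ I.X.S
    · rw [I.X.qPilot_apply_of_mem hS]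
      exact div_nonneg (by exact_mod_cast (I.X.ordq_pos hS).le) (by positivity)
    · rw [I.X.qPilot_apply_of_not_mem hS]
  · exact le_rfl

/-- `deĝ̲(P_{Θ,i}|_p) = (i+1)²·deĝ̲(P_q|_p)` (`P_{Θ,i} = (i+1)²·P_q`). [cite: DupuyHilado2025, §3.3] -/
theorem ndeg_thetaPilot_at_eq (p : ℕ) (i : Fin I.lstar) :
    FinDivisor.ndeg F₀ (∑ v : placesOver F₀ p, FinDivisor.of v.1 (I.X.thetaPilot i v.1)) =
      (((i : ℕ) + 1 : ℝ) ^ 2) *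
        FinDivisor.ndeg F₀ (∑ v : placesOver F₀ p, FinDivisor.of v.1 (I.X.qPilot v.1)) := by
  have h : (∑ v : placesOver F₀ p, FinDivisor.of v.1 (I.X.thetaPilot i v.1)) =
      (((i : ℕ) + 1 : ℝ) ^ 2) • ∑ v : placesOver F₀ p, FinDivisor.of v.1 (I.X.qPilot v.1) := by
    rw [Finset.smul_sum]
    refine Finset.sum_congr rfl fun v _ => ?_
    rw [I.X.thetaPilot_eq_smul i, Finsupp.smul_apply, smul_eq_mul]
    simp only [FinDivisor.of, Finsupp.smul_single, smul_eq_mul]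
  rw [h, map_smul, smul_eq_mul]

/-! ## The all-bad mass at a prime -/

/-- **The all-bad mass bound at a prime.** With `β_p := Σ_{v|p, v∈𝕍^bad} Pr(v)` and `P_q|_p := Σ_{v|p} P_q(v)[v]`:
`−(1/ℓ⋇)·Σ_{i<ℓ⋇} (i+1)²·β_p^{i+1}·deĝ̲(P_q|_p) ≤ negLogThetaLoc I p` — the slot-choice bound of
`GenuineLogThetaSlotChoice` at the selector «a good slot if the tuple has one», where only all-bad tuples (weight
`β_p^{i+2}`) contribute, computed by coordinate independence. [cite: DupuyHilado2025, §3.6, §4.7, §4.12]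
[cite: Mochizuki2012, IUTchIV Thm. 1.10 Step (v) p. 27–28] -/
theorem negLogThetaLoc_ge_badMass (p : ℕ) [hp : Fact p.Prime] :
    -((1 / (I.lstar : ℝ)) * ∑ i : Fin I.lstar, (((i : ℕ) + 1 : ℝ) ^ 2) *
        (∑ v : placesOver F₀ p, (I.X.S : Set (HeightOneSpectrum (𝓞 F₀))).indicator (weight F₀) v.1) ^ ((i : ℕ) + 1) *
        FinDivisor.ndeg F₀ (∑ v : placesOver F₀ p, FinDivisor.of v.1 (I.X.qPilot v.1))) ≤
      I.negLogThetaLoc p := by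
  classical
  -- the selector: a good slot if there is one, else slot `0`
  let s : (i : Fin I.lstar) → (Fin ((i : ℕ) + 1 + 1) → placesOver F₀ p) → Fin ((i : ℕ) + 1 + 1) :=
    fun i e => if h : ∃ a, (e a).1 ∉ I.X.S then h.choose else 0
  have h1 := I.negLogThetaLoc_ge_slotChoice p s
  refine le_trans (le_of_eq ?_) h1
  rw [neg_mul_eq_mul_neg, ← Finset.sum_neg_distrib]
  congr 1
  refine Finset.sum_congr rfl fun i _ => ?_
  -- per degree `i`: the sum over tuples
  set badw : placesOver F₀ p → ℝ := fun v => (I.X.S : Set (HeightOneSpectrum (𝓞 F₀))).indicator (weight F₀) v.1 with hbadw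
  set f : placesOver F₀ p → ℝ :=
    fun v => I.X.thetaPilot i v.1 * logNorm F₀ v.1 / localDegree F₀ v.1 with hf
  have key : ∀ e : Fin ((i : ℕ) + 1 + 1) → placesOver F₀ p,
      (-(I.X.thetaPilot i (e (s i e)).1) * logNorm F₀ (e (s i e)).1 / localDegree F₀ (e (s i e)).1) *
          ∏ b, weight F₀ (e b).1 = -(f (e 0) * ∏ b, badw (e b)) := by
    intro e
    by_cases hgood : ∃ a, (e a).1 ∉ I.X.S
    · have hs : s i e = hgood.choose := dif_pos hgood
      have hP : I.X.thetaPilot i (e (s i e)).1 = 0 := by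
        rw [hs]; exact I.X.thetaPilot_apply_of_not_mem i hgood.choose_spec
      obtain ⟨a, ha⟩ := hgood
      have hprod : ∏ b, badw (e b) = 0 :=
        Finset.prod_eq_zero (Finset.mem_univ a) (by
          simp only [hbadw]
          exact Set.indicator_of_notMem (fun h => ha (Finset.mem_coe.mp h)) _)
      rw [hP, hprod]; ring
    · have hs : s i e = 0 := dif_neg hgood
      have hall : ∀ a, (e a).1 ∈ I.X.S := fun a => by
        by_contra hna
        exact hgood ⟨a, hna⟩
      have hprod : ∏ b, badw (e b) = ∏ b, weight F₀ (e b).1 :=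
        Finset.prod_congr rfl fun b _ => by
          simp only [hbadw]
          exact Set.indicator_of_mem (Finset.mem_coe.mpr (hall b)) _
      rw [hs, hprod]
      simp only [hf]
      ring
  rw [Finset.sum_congr rfl fun e _ => key e, Finset.sum_neg_distrib,
    sum_apply_mul_prod_eq ((i : ℕ) + 1) 0 f badw]
  -- `Σ_v f(v)·badw(v) = Σ_v f(v)·Pr(v) = deĝ̲(P_{Θ,i}|_p) = (i+1)²·deĝ̲(P_q|_p)`
  have hfw : ∑ v : placesOver F₀ p, f v * badw v = ∑ v : placesOver F₀ p, f v * weight F₀ v.1 := by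
    refine Finset.sum_congr rfl fun v _ => ?_
    by_cases hS : v.1 ∈ I.X.S
    · simp only [hbadw, Set.indicator_of_mem (Finset.mem_coe.mpr hS)]
    · have : f v = 0 := by
        simp only [hf, I.X.thetaPilot_apply_of_not_mem i hS, zero_mul, zero_div]
      rw [this, zero_mul, zero_mul]
  have hexp := expect_neg_deg_div_localDegree' F₀ p (fun v => I.X.thetaPilot i v.1)
  rw [ProbWeights.expect] at hexp
  simp only [localWeights_pr] at hexp
  have hfw' : ∑ v : placesOver F₀ p, f v * weight F₀ v.1 =
      FinDivisor.ndeg F₀ (∑ v : placesOver F₀ p, FinDivisor.of v.1 (I.X.thetaPilot i v.1)) := by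
    have : ∑ v : placesOver F₀ p, f v * weight F₀ v.1 =
        -∑ v : placesOver F₀ p, -(I.X.thetaPilot i v.1 * logNorm F₀ v.1) / localDegree F₀ v.1 *
          ((localDegree F₀ v.1 : ℝ) / Module.finrank ℚ F₀) := by
      rw [← Finset.sum_neg_distrib]
      refine Finset.sum_congr rfl fun v _ => ?_
      simp only [hf, weight]
      ring
    rw [this, hexp, neg_neg]
  rw [hfw, hfw', I.ndeg_thetaPilot_at_eq p i]
  ring

/-- **The all-bad mass bound for the genuine `−|log(Θ)|`**:
`−Σ_{p∈T(I)} (1/ℓ⋇)·Σ_{i<ℓ⋇} (i+1)²·β_p^{i+1}·deĝ̲(P_q|_p) ≤ negLogThetaNonarch I`.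
[cite: DupuyHilado2025, §1 (1.1), §3.6, §4.12] [cite: Mochizuki2012, IUTchIV Thm. 1.10 Step (v) p. 27–28] -/
theorem negLogThetaNonarch_ge_badMass :
    -(∑ p ∈ I.supportPrimes, (1 / (I.lstar : ℝ)) * ∑ i : Fin I.lstar, (((i : ℕ) + 1 : ℝ) ^ 2) *
        (∑ v : placesOver F₀ p, (I.X.S : Set (HeightOneSpectrum (𝓞 F₀))).indicator (weight F₀) v.1) ^ ((i : ℕ) + 1) *
        FinDivisor.ndeg F₀ (∑ v : placesOver F₀ p, FinDivisor.of v.1 (I.X.qPilot v.1))) ≤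
      I.negLogThetaNonarch := by
  unfold negLogThetaNonarch
  rw [← Finset.sum_neg_distrib]
  refine Finset.sum_le_sum fun p hpT => ?_
  haveI : Fact p.Prime := ⟨I.prime_of_mem_supportPrimes hpT⟩
  exact I.negLogThetaLoc_ge_badMass p

/-! ## The sufficient conditions -/

/-- **If `(1/ℓ⋇)·Σ_{i<ℓ⋇} (i+1)²·β_p^{i+1} ≤ 1` at every support prime `p` (`β_p` = the bad mass over `p`), then
Dupuy–Hilado's (1.1) holds for the input**: `−deĝ̲(P_q) = −Σ_p deĝ̲(P_q|_p) ≤ −Σ_p c_p·deĝ̲(P_q|_p) ≤ negLogThetaNonarch I`.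
A theorem about the tree's typed objects; no side taken on print's Cor. 3.12. [claim: Mochizuki2012, status: disputed]
[cite: DupuyHilado2025, §1 (1.1), §3.6, §4.7, §4.12] -/
theorem cor312NonarchOf_of_badMass_le
    (h : ∀ p ∈ I.supportPrimes, (1 / (I.lstar : ℝ)) * ∑ i : Fin I.lstar, (((i : ℕ) + 1 : ℝ) ^ 2) *
        (∑ v : placesOver F₀ p, (I.X.S : Set (HeightOneSpectrum (𝓞 F₀))).indicator (weight F₀) v.1) ^ ((i : ℕ) + 1) ≤ 1) :
    I.Cor312NonarchOf := by
  unfold Cor312NonarchOf negAbsLogQ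
  refine le_trans ?_ I.negLogThetaNonarch_ge_badMass
  rw [I.ndeg_qPilot_eq_sum_primes, neg_le_neg_iff]
  refine Finset.sum_le_sum fun p hpT => ?_
  have hD := I.ndeg_qPilot_at_nonneg p
  have heq : (1 / (I.lstar : ℝ)) * ∑ i : Fin I.lstar, (((i : ℕ) + 1 : ℝ) ^ 2) *
        (∑ v : placesOver F₀ p, (I.X.S : Set (HeightOneSpectrum (𝓞 F₀))).indicator (weight F₀) v.1) ^ ((i : ℕ) + 1) *
        FinDivisor.ndeg F₀ (∑ v : placesOver F₀ p, FinDivisor.of v.1 (I.X.qPilot v.1)) =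
      ((1 / (I.lstar : ℝ)) * ∑ i : Fin I.lstar, (((i : ℕ) + 1 : ℝ) ^ 2) *
        (∑ v : placesOver F₀ p, (I.X.S : Set (HeightOneSpectrum (𝓞 F₀))).indicator (weight F₀) v.1) ^ ((i : ℕ) + 1)) *
        FinDivisor.ndeg F₀ (∑ v : placesOver F₀ p, FinDivisor.of v.1 (I.X.qPilot v.1)) := by
    rw [Finset.mul_sum, Finset.mul_sum, Finset.sum_mul]
    exact Finset.sum_congr rfl fun i _ => by ring
  rw [heq]
  calc ((1 / (I.lstar : ℝ)) * ∑ i : Fin I.lstar, (((i : ℕ) + 1 : ℝ) ^ 2) *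
          (∑ v : placesOver F₀ p, (I.X.S : Set (HeightOneSpectrum (𝓞 F₀))).indicator (weight F₀) v.1) ^ ((i : ℕ) + 1)) *
          FinDivisor.ndeg F₀ (∑ v : placesOver F₀ p, FinDivisor.of v.1 (I.X.qPilot v.1))
        ≤ 1 * FinDivisor.ndeg F₀ (∑ v : placesOver F₀ p, FinDivisor.of v.1 (I.X.qPilot v.1)) :=
          mul_le_mul_of_nonneg_right (h p hpT) hD
    _ = _ := one_mul _

/-- **… hence [IUTchIII] Cor. 3.12 for the input** (`Cor312Of I`) under the same bad-mass condition.
[claim: Mochizuki2012, status: disputed] [cite: Mochizuki2012, IUTchIII Cor. 3.12 p. 173–174] -/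
theorem cor312Of_of_badMass_le
    (h : ∀ p ∈ I.supportPrimes, (1 / (I.lstar : ℝ)) * ∑ i : Fin I.lstar, (((i : ℕ) + 1 : ℝ) ^ 2) *
        (∑ v : placesOver F₀ p, (I.X.S : Set (HeightOneSpectrum (𝓞 F₀))).indicator (weight F₀) v.1) ^ ((i : ℕ) + 1) ≤ 1) :
    I.Cor312Of :=
  I.cor312Of_of_cor312NonarchOf (I.cor312NonarchOf_of_badMass_le h)

/-- The bad mass over `p` is nonnegative. [cite: DupuyHilado2025, §3.6] -/
theorem badMass_nonneg (p : ℕ) :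
    0 ≤ ∑ v : placesOver F₀ p, (I.X.S : Set (HeightOneSpectrum (𝓞 F₀))).indicator (weight F₀) v.1 :=
  Finset.sum_nonneg fun _ _ => Set.indicator_nonneg (fun w _ => weight_nonneg F₀ w) _

/-- **[IUTchIII] Cor. 3.12 (the tree's sharp Dupuy–Hilado-level `Cor312Of`) HOLDS for every genuine Θ-volume input
whose bad places over each rational prime carry at most a third of the degree**: if
`β_p = Σ_{v|p, v∈𝕍^bad} n_v/[F₀:ℚ] ≤ 1/3` at every support prime `p`, then `Cor312NonarchOf I` and `Cor312Of I`
(each term `(i+1)²·β_p^{i+1} ≤ (i+1)²/3^{i+1} ≤ 1`). Whatever the depths `ord_v(q_v)`, `l`, `K` or the ideles. A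
theorem about the tree's typed objects ((Ind1) = all capsule-index permutations); no side taken on print's Cor. 3.12;
the route to `Summit.ABC` runs over `F_mod = ℚ` where `β_p = 1`. [claim: Mochizuki2012, status: disputed]
[cite: DupuyHilado2025, §3.6, §4.7, §4.12] [cite: Mochizuki2012, IUTchIII Cor. 3.12 p. 173–174] -/
theorem cor312Of_of_badMass_le_third
    (h : ∀ p ∈ I.supportPrimes, ∑ v : placesOver F₀ p, (I.X.S : Set (HeightOneSpectrum (𝓞 F₀))).indicator (weight F₀) v.1 ≤ 1 / 3) :
    I.Cor312NonarchOf ∧ I.Cor312Of := by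
  have hc : ∀ p ∈ I.supportPrimes, (1 / (I.lstar : ℝ)) * ∑ i : Fin I.lstar, (((i : ℕ) + 1 : ℝ) ^ 2) *
      (∑ v : placesOver F₀ p, (I.X.S : Set (HeightOneSpectrum (𝓞 F₀))).indicator (weight F₀) v.1) ^ ((i : ℕ) + 1) ≤ 1 := by
    intro p hpT
    have hβ0 := I.badMass_nonneg p
    have hβ := h p hpT
    have hterm : ∀ i : Fin I.lstar, (((i : ℕ) + 1 : ℝ) ^ 2) *
        (∑ v : placesOver F₀ p, (I.X.S : Set (HeightOneSpectrum (𝓞 F₀))).indicator (weight F₀) v.1) ^ ((i : ℕ) + 1) ≤ 1 := by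
      intro i
      have h3 : (0 : ℝ) < (3 : ℝ) ^ ((i : ℕ) + 1) := by positivity
      have hpow : (∑ v : placesOver F₀ p, (I.X.S : Set (HeightOneSpectrum (𝓞 F₀))).indicator (weight F₀) v.1) ^ ((i : ℕ) + 1) ≤
          (1 / 3 : ℝ) ^ ((i : ℕ) + 1) := pow_le_pow_left₀ hβ0 hβ _
      have hsq := natCast_sq_le_three_pow ((i : ℕ) + 1)
      push_cast at hsq
      calc (((i : ℕ) + 1 : ℝ) ^ 2) *
            (∑ v : placesOver F₀ p, (I.X.S : Set (HeightOneSpectrum (𝓞 F₀))).indicator (weight F₀) v.1) ^ ((i : ℕ) + 1)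
          ≤ (3 : ℝ) ^ ((i : ℕ) + 1) * (1 / 3 : ℝ) ^ ((i : ℕ) + 1) :=
            mul_le_mul hsq hpow (pow_nonneg hβ0 _) h3.le
        _ = 1 := by rw [← mul_pow]; norm_num
    have hsum : ∑ i : Fin I.lstar, (((i : ℕ) + 1 : ℝ) ^ 2) *
        (∑ v : placesOver F₀ p, (I.X.S : Set (HeightOneSpectrum (𝓞 F₀))).indicator (weight F₀) v.1) ^ ((i : ℕ) + 1) ≤ I.lstar := by
      calc ∑ i : Fin I.lstar, (((i : ℕ) + 1 : ℝ) ^ 2) *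
            (∑ v : placesOver F₀ p, (I.X.S : Set (HeightOneSpectrum (𝓞 F₀))).indicator (weight F₀) v.1) ^ ((i : ℕ) + 1)
          ≤ ∑ _i : Fin I.lstar, (1 : ℝ) := Finset.sum_le_sum fun i _ => hterm i
        _ = I.lstar := by simp
    rcases Nat.eq_zero_or_pos I.lstar with h0 | hpos
    · rw [h0]; simp
    · have hl : (0 : ℝ) < I.lstar := by exact_mod_cast hpos
      rw [one_div, inv_mul_le_iff₀ hl, mul_one]
      exact hsum
  exact ⟨I.cor312NonarchOf_of_badMass_le hc, I.cor312Of_of_badMass_le hc⟩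

end ThetaVolumeInput

end Literature.IUT.LogVolume

end
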